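import Mathlib
import Summits.Ventures.HodgeRepro2.T5InertSphericalClassification

/-!
# THE SPHERICAL VECTOR OF `I(c)` EXISTS: `f₀(n a_m κ) = c^m`

Tier-5 support N3 / §G-N4.2 (seat p3, gen 84). The Macdonald–Satake identification (`T5InertIwasawa`'s
`heckeSMul_cellU_one_eq_smul_param'`) and file 334's `exists_param_heckeSMul_cellU_one_eq` quantify over a
spherical vector `f₀ ∈ I(c)^K` with `f₀(1) = 1`. This file constructs it, so that those statements are
non-vacuous (README §10.5 (ii)(c)): by the Iwasawa decomposition `G = N {a_m} K` (`exists_mem_mul_cellZ_mul`)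
every `g` is `n a_m κ`, and `m` is unique (`eq_of_mul_cellZ_mul_eq`).

* **`iwasawaExp g`** — the unique `m` with `g ∈ N a_m K` (`iwasawaExp_spec`, **`iwasawaExp_eq_of`**);
  `iwasawaExp_mul_left_of_mem` (`N`-invariant on the left), **`iwasawaExp_cellZ_mul`** (`m(a_j g) = j + m(g)`,
  by `a_j N a_j⁻¹ ⊆ N`), `iwasawaExp_mul_right_of_mem` (`K`-invariant on the right), `iwasawaExp_one`;
* **`sphericalVector c := fun g => c ^ iwasawaExp g`** — `isInduced_sphericalVector` (`c ≠ 0`),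
  **`sphericalVector_mem_invariants`**, `sphericalVector_one`;
* **`exists_isInduced_mem_invariants_apply_one`** — `I(c)^K` contains a vector with `f₀(1) = 1` for every `c ≠ 0`;
* **`heckeSMul_cellU_one_sphericalVector`** — `T₁ · sphericalVector (α q⁻²) = (q²(α + α⁻¹) + (q − 1)) •
  sphericalVector (α q⁻²)` for every `α ≠ 0` — the Macdonald–Satake identification on a CONSTRUCTED vector;
  **`exists_param_heckeSMul_sphericalVector_eq`** — for every `λ` some `α ≠ 0` realises it.

Nothing here is a statement about (P), theta lifts or L-values. §8(d): uses an L-value-free non-vanishing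
device: NO.
-/

open Summit.Ventures.HodgeRepro2.T5HeckeBasisCells Summit.Ventures.HodgeRepro2.T5HeckePermutationModule
  Summit.Ventures.HodgeRepro2.LevelPositivity Summit.Ventures.HodgeRepro2.T5UnitaryGroupForm
  Summit.Ventures.HodgeRepro2.T5HermitianThreeElements Summit.Ventures.HodgeRepro2.T5UnitaryHeckeAdjoint
  Summit.Ventures.HodgeRepro2.T5InertUnipotentResidue Summit.Ventures.HodgeRepro2.T5InertSatakeTransform
  Summit.Ventures.HodgeRepro2.T5InertPrincipalSeries Summit.Ventures.HodgeRepro2.T5InertIwasawa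
  Summit.Ventures.HodgeRepro2.T5HeckeDoubleCoset Summit.Ventures.HodgeRepro2.T5InertUnipotentRadical
  Summit.Ventures.HodgeRepro2.T5InertIwasawaCosets Summit.Ventures.HodgeRepro2.T5InertSphericalClassification

namespace Summit.Ventures.HodgeRepro2.T5InertSphericalVector

section Exponent

variable {R E : Type*} [CommRing R] [Field E] [StarRing E] [Algebra R E] [IsFractionRing R E] [IsDomain R]
  [IsDiscreteValuationRing R] [Finite (IsLocalRing.ResidueField R)]
  (hstar : ∀ x : E, IsLocalization.IsInteger R x → IsLocalization.IsInteger R (star x))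
  (u : E) (hsu : star u = u) (hu0 : u ≠ 0) (hu : IsLocalization.IsInteger R u)
  (hu' : IsLocalization.IsInteger R u⁻¹) {ϖ : R} (hϖ : Irreducible ϖ)
  (hs : star (algebraMap R E ϖ) = algebraMap R E ϖ)

omit [Finite (IsLocalRing.ResidueField R)] in
include hstar hsu hu0 hu hu' in
/-- The Iwasawa decomposition with the exponent first: `∃ m, ∃ n ∈ N, ∃ κ ∈ K, g = n a_m κ`. -/
theorem exists_iwasawa (g : formUnitaryGroup (J3 u)) :
    ∃ m : ℤ, ∃ n ∈ upperUnipotent u, ∃ κ ∈ hyperspecialSubgroup R (J3 u), g = n * cellZ u hϖ hs m * κ := by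
  obtain ⟨n, hn, m, κ, hκ, hg⟩ := exists_mem_mul_cellZ_mul hstar u hsu hu0 hu hu' hϖ hs g
  exact ⟨m, n, hn, κ, hκ, hg⟩

/-- **The Iwasawa exponent `m(g)`**: the unique `m` with `g ∈ N a_m K`. -/
noncomputable def iwasawaExp (g : formUnitaryGroup (J3 u)) : ℤ :=
  Classical.choose (exists_iwasawa hstar u hsu hu0 hu hu' hϖ hs g)

omit [Finite (IsLocalRing.ResidueField R)] in
/-- `g = n a_{m(g)} κ` for some `n ∈ N`, `κ ∈ K`. -/
theorem iwasawaExp_spec (g : formUnitaryGroup (J3 u)) :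
    ∃ n ∈ upperUnipotent u, ∃ κ ∈ hyperspecialSubgroup R (J3 u),
      g = n * cellZ u hϖ hs (iwasawaExp hstar u hsu hu0 hu hu' hϖ hs g) * κ :=
  Classical.choose_spec (exists_iwasawa hstar u hsu hu0 hu hu' hϖ hs g)

/-- **Uniqueness**: `g = n a_m κ` with `n ∈ N`, `κ ∈ K` forces `m(g) = m` (`eq_of_mul_cellZ_mul_eq`). -/
theorem iwasawaExp_eq_of {g n κ : formUnitaryGroup (J3 u)} (hn : n ∈ upperUnipotent u)
    (hκ : κ ∈ hyperspecialSubgroup R (J3 u)) {m : ℤ} (h : g = n * cellZ u hϖ hs m * κ) :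
    iwasawaExp hstar u hsu hu0 hu hu' hϖ hs g = m := by
  obtain ⟨n', hn', κ', hκ', hg⟩ := iwasawaExp_spec hstar u hsu hu0 hu hu' hϖ hs g
  exact eq_of_mul_cellZ_mul_eq hstar u hsu hu0 hu hu' hϖ hs hn' hn hκ' hκ (hg.symm.trans h)

/-- `m(n g) = m(g)` for `n ∈ N`. -/
theorem iwasawaExp_mul_left_of_mem {n : formUnitaryGroup (J3 u)} (hn : n ∈ upperUnipotent u)
    (g : formUnitaryGroup (J3 u)) :
    iwasawaExp hstar u hsu hu0 hu hu' hϖ hs (n * g) = iwasawaExp hstar u hsu hu0 hu hu' hϖ hs g := by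
  obtain ⟨n', hn', κ', hκ', hg⟩ := iwasawaExp_spec hstar u hsu hu0 hu hu' hϖ hs g
  refine iwasawaExp_eq_of hstar u hsu hu0 hu hu' hϖ hs (Subgroup.mul_mem _ hn hn') hκ' ?_
  conv_lhs => rw [hg]
  group

/-- **`m(a_j g) = j + m(g)`** (`a_j n a_j⁻¹ ∈ N` and `a_j a_m = a_{j+m}`). -/
theorem iwasawaExp_cellZ_mul (j : ℤ) (g : formUnitaryGroup (J3 u)) :
    iwasawaExp hstar u hsu hu0 hu hu' hϖ hs (cellZ u hϖ hs j * g) =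
      j + iwasawaExp hstar u hsu hu0 hu hu' hϖ hs g := by
  obtain ⟨n', hn', κ', hκ', hg⟩ := iwasawaExp_spec hstar u hsu hu0 hu hu' hϖ hs g
  refine iwasawaExp_eq_of hstar u hsu hu0 hu hu' hϖ hs (conj_cellZ_mem_upperUnipotent u hϖ hs j hn') hκ' ?_
  conv_lhs => rw [hg]
  rw [← cellZ_mul u hϖ hs]
  group

/-- `m(g κ) = m(g)` for `κ ∈ K`. -/
theorem iwasawaExp_mul_right_of_mem (g : formUnitaryGroup (J3 u)) {κ : formUnitaryGroup (J3 u)}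
    (hκ : κ ∈ hyperspecialSubgroup R (J3 u)) :
    iwasawaExp hstar u hsu hu0 hu hu' hϖ hs (g * κ) = iwasawaExp hstar u hsu hu0 hu hu' hϖ hs g := by
  obtain ⟨n', hn', κ', hκ', hg⟩ := iwasawaExp_spec hstar u hsu hu0 hu hu' hϖ hs g
  refine iwasawaExp_eq_of hstar u hsu hu0 hu hu' hϖ hs hn' (Subgroup.mul_mem _ hκ' hκ) ?_
  conv_lhs => rw [hg]
  group

/-- `m(1) = 0`. -/
theorem iwasawaExp_one : iwasawaExp hstar u hsu hu0 hu hu' hϖ hs 1 = 0 :=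
  iwasawaExp_eq_of hstar u hsu hu0 hu hu' hϖ hs (Subgroup.one_mem _) (Subgroup.one_mem _)
    (by rw [cellZ_zero, one_mul, one_mul])

end Exponent

section Vector

variable {R E : Type*} [CommRing R] [Field E] [StarRing E] [Algebra R E] [IsFractionRing R E] [IsDomain R]
  [IsDiscreteValuationRing R] [Finite (IsLocalRing.ResidueField R)]
  (hstar : ∀ x : E, IsLocalization.IsInteger R x → IsLocalization.IsInteger R (star x))
  (u : E) (hsu : star u = u) (hu0 : u ≠ 0) (hu : IsLocalization.IsInteger R u)
  (hu' : IsLocalization.IsInteger R u⁻¹) {ϖ : R} (hϖ : Irreducible ϖ)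
  (hs : star (algebraMap R E ϖ) = algebraMap R E ϖ) (k : Type*) [Field k]

/-- **The spherical vector of `I(c)`**: `f₀(n a_m κ) = c^m`. -/
noncomputable def sphericalVector (c : k) : formUnitaryGroup (J3 u) → k :=
  fun g => c ^ iwasawaExp hstar u hsu hu0 hu hu' hϖ hs g

omit [Finite (IsLocalRing.ResidueField R)] in
/-- `f₀(g) = c^{m(g)}`. -/
theorem sphericalVector_apply (c : k) (g : formUnitaryGroup (J3 u)) :
    sphericalVector hstar u hsu hu0 hu hu' hϖ hs k c g = c ^ iwasawaExp hstar u hsu hu0 hu hu' hϖ hs g := rfl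

/-- **`f₀ ∈ I(c)`** for `c ≠ 0`: `f₀(n g) = f₀(g)` and `f₀(a_m g) = c^m f₀(g)`. -/
theorem isInduced_sphericalVector {c : k} (hc : c ≠ 0) :
    IsInduced u hϖ hs k c (sphericalVector hstar u hsu hu0 hu hu' hϖ hs k c) := by
  refine ⟨fun n hn g => ?_, fun m g => ?_⟩
  · rw [sphericalVector_apply, sphericalVector_apply, iwasawaExp_mul_left_of_mem hstar u hsu hu0 hu hu' hϖ hs hn]
  · rw [sphericalVector_apply, sphericalVector_apply, iwasawaExp_cellZ_mul, zpow_add₀ hc]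

/-- **`f₀` is right `K`-invariant**. -/
theorem sphericalVector_mem_invariants (c : k) :
    sphericalVector hstar u hsu hu0 hu hu' hϖ hs k c ∈
      invariants (rightRegular k) (hyperspecialSubgroup R (J3 u)) := by
  rw [mem_invariants_rightRegular_iff]
  intro κ hκ x
  rw [sphericalVector_apply, sphericalVector_apply, iwasawaExp_mul_right_of_mem hstar u hsu hu0 hu hu' hϖ hs x hκ]

/-- `f₀(1) = 1`. -/
theorem sphericalVector_one (c : k) : sphericalVector hstar u hsu hu0 hu hu' hϖ hs k c 1 = 1 := by
  rw [sphericalVector_apply, iwasawaExp_one, zpow_zero]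

include hstar hsu hu0 hu hu' in
/-- **`I(c)^K` contains a vector with `f₀(1) = 1`**, for every `c ≠ 0` (the non-vacuity of the spherical-vector
quantifier of `T5InertIwasawa.heckeSMul_cellU_one_eq_smul_param'`). -/
theorem exists_isInduced_mem_invariants_apply_one {c : k} (hc : c ≠ 0) :
    ∃ f₀ : formUnitaryGroup (J3 u) → k, IsInduced u hϖ hs k c f₀ ∧
      f₀ ∈ invariants (rightRegular k) (hyperspecialSubgroup R (J3 u)) ∧ f₀ 1 = 1 :=
  ⟨sphericalVector hstar u hsu hu0 hu hu' hϖ hs k c, isInduced_sphericalVector hstar u hsu hu0 hu hu' hϖ hs k hc,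
    sphericalVector_mem_invariants hstar u hsu hu0 hu hu' hϖ hs k c, sphericalVector_one hstar u hsu hu0 hu hu' hϖ hs k c⟩

end Vector

section Eigenvalue

variable {R E : Type*} [CommRing R] [Field E] [StarRing E] [Algebra R E] [IsFractionRing R E] [IsDomain R]
  [IsDiscreteValuationRing R] [Finite (IsLocalRing.ResidueField R)]
  (hstar : ∀ x : E, IsLocalization.IsInteger R x → IsLocalization.IsInteger R (star x))
  (u : E) (hsu : star u = u) (hu0 : u ≠ 0) (hu : IsLocalization.IsInteger R u)
  (hu' : IsLocalization.IsInteger R u⁻¹) {ϖ : R} (hϖ : Irreducible ϖ)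
  (hs : star (algebraMap R E ϖ) = algebraMap R E ϖ) (k : Type*) [Field k] [CharZero k]
  [Finite (MulAction.orbit (hyperspecialSubgroup R (J3 u))
    ((cellU hϖ hs u 1 : formUnitaryGroup (J3 u)) : formUnitaryGroup (J3 u) ⧸ hyperspecialSubgroup R (J3 u)))]
  (he : ∃ e : R, algebraMap R E e + star (algebraMap R E e) = 1)
  (hnt : ∃ t, T5InertResidueInvolution.residueStar hstar hϖ hs t ≠ t)

include he hnt in
/-- **THE MACDONALD–SATAKE IDENTIFICATION ON THE CONSTRUCTED SPHERICAL VECTOR**: for every `α ≠ 0`,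
`T₁ · sphericalVector (α q⁻²) = (q²(α + α⁻¹) + (q − 1)) • sphericalVector (α q⁻²)`. -/
theorem heckeSMul_cellU_one_sphericalVector {α : k} (hα : α ≠ 0) :
    heckeSMul (rightRegular k) (doubleCosetOp k (hyperspecialSubgroup R (J3 u)) (cellU hϖ hs u 1))
        ⟨sphericalVector hstar u hsu hu0 hu hu' hϖ hs k (α * ((Nat.card (traceZero R E) : k) ^ 2)⁻¹),
          sphericalVector_mem_invariants hstar u hsu hu0 hu hu' hϖ hs k _⟩ =
      ((Nat.card (traceZero R E) : k) ^ 2 * (α + α⁻¹) + ((Nat.card (traceZero R E) : k) - 1)) •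
        ⟨sphericalVector hstar u hsu hu0 hu hu' hϖ hs k (α * ((Nat.card (traceZero R E) : k) ^ 2)⁻¹),
          sphericalVector_mem_invariants hstar u hsu hu0 hu hu' hϖ hs k _⟩ :=
  heckeSMul_cellU_one_eq_smul_param' hstar u hsu hu0 hu hu' hϖ hs k he hnt hα
    (isInduced_sphericalVector hstar u hsu hu0 hu hu' hϖ hs k
      (mul_ne_zero hα (inv_ne_zero (pow_ne_zero 2 (natCast_card_traceZero_ne_zero (R := R) (E := E) k)))))
    (sphericalVector_mem_invariants hstar u hsu hu0 hu hu' hϖ hs k _)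
    (sphericalVector_one hstar u hsu hu0 hu hu' hϖ hs k _)

include he hnt in
/-- **EVERY `λ` IS THE `T₁`-EIGENVALUE OF A CONSTRUCTED SPHERICAL VECTOR**: for every `λ : k` (`k` algebraically
closed) there is `α ≠ 0` with `T₁ · sphericalVector (α q⁻²) = λ • sphericalVector (α q⁻²)`. -/
theorem exists_param_heckeSMul_sphericalVector_eq [IsAlgClosed k] (lam : k) :
    ∃ α : k, α ≠ 0 ∧
      heckeSMul (rightRegular k) (doubleCosetOp k (hyperspecialSubgroup R (J3 u)) (cellU hϖ hs u 1))
          ⟨sphericalVector hstar u hsu hu0 hu hu' hϖ hs k (α * ((Nat.card (traceZero R E) : k) ^ 2)⁻¹),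
            sphericalVector_mem_invariants hstar u hsu hu0 hu hu' hϖ hs k _⟩ =
        lam • ⟨sphericalVector hstar u hsu hu0 hu hu' hϖ hs k (α * ((Nat.card (traceZero R E) : k) ^ 2)⁻¹),
            sphericalVector_mem_invariants hstar u hsu hu0 hu hu' hϖ hs k _⟩ := by
  obtain ⟨α, hα, hlam⟩ := exists_param_eq ((Nat.card (traceZero R E) : ℕ) : k)
    (natCast_card_traceZero_ne_zero (R := R) (E := E) k) lam
  refine ⟨α, hα, ?_⟩
  rw [heckeSMul_cellU_one_sphericalVector hstar u hsu hu0 hu hu' hϖ hs k he hnt hα, hlam]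

end Eigenvalue

end Summit.Ventures.HodgeRepro2.T5InertSphericalVector
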